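import Literature.Analysis.FluidPDE.WholeSpacePressureL3
import Literature.Analysis.FluidPDE.WeaklyHarmonicInteriorBound
import Literature.Analysis.FluidPDE.WeakGradientSlicing
import HarnessLib

/-!
# The pressure decay estimate on balls (one time slice)

Analysis/FluidPDE support file in the discharge of the named fact
`Literature.Analysis.FluidPDE.seregin_sverak_pressure_decay` (`FluidPDE/PressureDecayEstimate`;
Seregin–Šverák 2009, (as13); Seregin 2005, (p9)–(p12)): the **spatial step** of the printed
argument, at a fixed time. Let `p ∈ L^{3/2}(B_r(x₀))`, `u ∈ L³(B_r(x₀))` satisfy the pressure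
equation `-Δ p = div div (u ⊗ u)` weakly in the ball,

  `∫ p Δψ = -∫ D²ψ(u, u)` for all `ψ ∈ C_c^∞` with `supp ψ ⊆ B_r(x₀)`.

Then for `0 < ϱ ≤ r/2`

  `∫_{B_ϱ} |p|^{3/2} ≤ c [ (ϱ/r)³ ∫_{B_r} |p|^{3/2} + ∫_{B_r} |u|³ ]`

with an absolute constant `c` (`setLIntegral_pressure_ball_le_of_stein`). Proof as printed
(Seregin 2005, (p9)–(p12); Seregin, *Lecture notes* (2014), §6.3, proof of Prop. 3.10): split
`p = p₁ + p₂` on `B_r`, where `p₁` is the whole-space pressure of `χ_{B_r} u`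
(`exists_wholeSpacePressure_of_stein`: `‖p₁‖_{3/2} ≤ C ‖u‖²_{3,B_r}`, from Stein's bound on test
fields, the only unproved input) and `p₂ = p - p₁` is weakly harmonic in `B_r`, so that
`sup_{B_{r/2}} |p₂| ≤ C r⁻³ ∫_{B_r} |p₂|` (`exists_const_ae_abs_le_integral_of_weaklyHarmonic`);
Hölder's inequality turns the last bound into
`∫_{B_ϱ} |p₂|^{3/2} ≤ C (ϱ/r)³ ∫_{B_r} |p₂|^{3/2}`.

## References

* G. Seregin, *Navier–Stokes equations: almost `L_{3,∞}`-case*, J. Math. Fluid Mech. 9 (2007),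
  arXiv:math/0510396, (p9)–(p12). [Seregin2005]
* G. Seregin, V. Šverák, *On Type I singularities of the local axi-symmetric solutions of the
  Navier–Stokes equations*, Comm. PDE 34 (2009), arXiv:0804.1803, (as13). [SereginSverak2009]
* G. Seregin, *Lecture Notes on Regularity Theory for the Navier–Stokes Equations*, World
  Scientific 2014, §6.3. [Seregin2014]
-/

noncomputable section

open MeasureTheory Set Filter Metric Topology Function
open scoped ENNReal NNReal ContDiff Laplacian

namespace Literature.Analysis.FluidPDE

/-! ### Auxiliary facts -/

section Aux

/-- Second derivatives vanish off the topological support. [folklore] -/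
theorem fderiv_fderiv_eq_zero_of_notMem_tsupport {X : Type*} [NormedAddCommGroup X]
    [NormedSpace ℝ X] {φ : X → ℝ} {x : X} (hx : x ∉ tsupport φ) :
    fderiv ℝ (fderiv ℝ φ) x = 0 :=
  fderiv_of_notMem_tsupport (𝕜 := ℝ) fun h => hx (tsupport_fderiv_subset ℝ h)

/-- `(r³)^{-3/2} (r³)^{1/2} ϱ³ = (ϱ/r)³` in `ℝ≥0∞`. [folklore] -/
theorem ofReal_cube_inv_rpow_mul (r ϱ : ℝ) (hr : 0 < r) :
    ENNReal.ofReal ((r ^ 3)⁻¹) ^ (3 / 2 : ℝ) * ENNReal.ofReal (r ^ 3) ^ (1 / 2 : ℝ) *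
        ENNReal.ofReal (ϱ ^ 3) = ENNReal.ofReal ((ϱ / r) ^ 3) := by
  have hr3 : 0 < r ^ 3 := pow_pos hr 3
  have hK0 : ENNReal.ofReal (r ^ 3) ≠ 0 := (ENNReal.ofReal_pos.2 hr3).ne'
  have hKt : ENNReal.ofReal (r ^ 3) ≠ ⊤ := ENNReal.ofReal_ne_top
  rw [ENNReal.ofReal_inv_of_pos hr3, ENNReal.inv_rpow, ← ENNReal.rpow_neg,
    ← ENNReal.rpow_add _ _ hK0 hKt, show (-(3 / 2 : ℝ) + 1 / 2) = -1 by norm_num,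
    ENNReal.rpow_neg_one, div_pow, ENNReal.ofReal_div_of_pos hr3, ENNReal.div_eq_inv_mul]

/-- Hölder on a set of finite measure: `(∫_s |h|)^{3/2} ≤ |s|^{1/2} ∫_s |h|^{3/2}`. [folklore] -/
theorem lintegral_enorm_rpow_threeHalves_le {X : Type*} [MeasurableSpace X] {μ : Measure X}
    {h : X → ℝ} (hh : AEStronglyMeasurable h μ) :
    (∫⁻ x, ‖h x‖ₑ ∂μ) ^ (3 / 2 : ℝ) ≤ (μ univ) ^ (1 / 2 : ℝ) * ∫⁻ x, ‖h x‖ₑ ^ (3 / 2 : ℝ) ∂μ := by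
  have hpq : Real.HolderConjugate (3 / 2 : ℝ) 3 := ⟨by norm_num, by norm_num, by norm_num⟩
  have h1 := ENNReal.lintegral_mul_le_Lp_mul_Lq μ hpq hh.enorm
    (aemeasurable_const (b := (1 : ℝ≥0∞)))
  simp only [Pi.mul_apply, mul_one, ENNReal.one_rpow, lintegral_const, one_mul] at h1
  have h2 := ENNReal.rpow_le_rpow h1 (by norm_num : (0 : ℝ) ≤ 3 / 2)
  rw [ENNReal.mul_rpow_of_nonneg _ _ (by norm_num : (0 : ℝ) ≤ 3 / 2), ← ENNReal.rpow_mul,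
    ← ENNReal.rpow_mul, show (1 / (3 / 2 : ℝ)) * (3 / 2) = 1 by norm_num, ENNReal.rpow_one,
    show (1 / (3 : ℝ)) * (3 / 2) = 1 / 2 by norm_num, mul_comm] at h2
  exact h2

/-- `(a + b)^{3/2} ≤ 2 (a^{3/2} + b^{3/2})` in `ℝ≥0∞`. [folklore] -/
theorem rpow_threeHalves_add_le_two_mul (a b : ℝ≥0∞) :
    (a + b) ^ (3 / 2 : ℝ) ≤ 2 * (a ^ (3 / 2 : ℝ) + b ^ (3 / 2 : ℝ)) := by
  have h := ENNReal.rpow_add_le_mul_rpow_add_rpow a b (by norm_num : (1 : ℝ) ≤ 3 / 2)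
  refine h.trans (mul_le_mul_left ?_ _)
  calc (2 : ℝ≥0∞) ^ ((3 / 2 : ℝ) - 1) ≤ 2 ^ (1 : ℝ) :=
        ENNReal.rpow_le_rpow_of_exponent_le (by norm_num) (by norm_num)
    _ = 2 := ENNReal.rpow_one _

end Aux

/-! ### The slice estimate -/

section Slice

-- nested operator types (curried second derivatives)
set_option maxSynthPendingDepth 3 in
/-- **Pressure decay on balls, one time slice** (Seregin 2005, (p9)–(p12); Seregin–Šverák 2009,
(as13), spatial part). There is an absolute constant `c` such that: if `p ∈ L^{3/2}(B_r(x₀))`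
and `u ∈ L³(B_r(x₀))` (a.e.-strongly measurable on the ball, with
`∫_{B_r} |p|^{3/2} < ∞`, `∫_{B_r} |u|³ < ∞`) satisfy `∫ p Δψ = -∫ D²ψ(u, u)` for every test
function `ψ` supported in `B_r(x₀)`, then for `0 < ϱ`, `2ϱ ≤ r`,
`∫_{B_ϱ} |p|^{3/2} ≤ c ((ϱ/r)³ ∫_{B_r} |p|^{3/2} + ∫_{B_r} |u|³)`.
The Calderón–Zygmund input is Stein's bound on test fields
(`stein1970_normalisedPressure_Lp_bound`), through `exists_wholeSpacePressure_of_stein`.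
[cite: Seregin2005, (p9)–(p12)][cite: SereginSverak2009, (as13)] -/
theorem setLIntegral_pressure_ball_le_of_stein (hS : stein1970_normalisedPressure_Lp_bound) :
    ∃ c : ℝ≥0, ∀ (x₀ : EuclideanSpace ℝ (Fin 3)) (r ϱ : ℝ) (p : EuclideanSpace ℝ (Fin 3) → ℝ)
      (u : EuclideanSpace ℝ (Fin 3) → EuclideanSpace ℝ (Fin 3)), 0 < ϱ → 2 * ϱ ≤ r →
      AEStronglyMeasurable p (volume.restrict (ball x₀ r)) →
      AEStronglyMeasurable u (volume.restrict (ball x₀ r)) →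
      ∫⁻ x in ball x₀ r, ‖p x‖ₑ ^ (3 / 2 : ℝ) < ⊤ →
      ∫⁻ x in ball x₀ r, ‖u x‖ₑ ^ (3 : ℕ) < ⊤ →
      (∀ ψ : EuclideanSpace ℝ (Fin 3) → ℝ, ContDiff ℝ (⊤ : ℕ∞) ψ → HasCompactSupport ψ →
        tsupport ψ ⊆ ball x₀ r →
        ∫ x, p x * (Δ ψ) x = -∫ x, fderiv ℝ (fderiv ℝ ψ) x (u x) (u x)) →
      ∫⁻ x in ball x₀ ϱ, ‖p x‖ₑ ^ (3 / 2 : ℝ) ≤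
        c * (ENNReal.ofReal ((ϱ / r) ^ 3) * (∫⁻ x in ball x₀ r, ‖p x‖ₑ ^ (3 / 2 : ℝ)) +
          ∫⁻ x in ball x₀ r, ‖u x‖ₑ ^ (3 : ℕ)) := by
  obtain ⟨C, hC⟩ := exists_wholeSpacePressure_of_stein hS
  obtain ⟨C₃, hC₃0, hB3⟩ := exists_const_ae_abs_le_integral_of_weaklyHarmonic
  -- the constants
  set V₁ : ℝ≥0∞ := volume (ball (0 : EuclideanSpace ℝ (Fin 3)) 1) with hV₁
  have hV₁t : V₁ ≠ ⊤ := measure_ball_lt_top.ne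
  set A : ℝ≥0∞ := (C : ℝ≥0∞) ^ (3 / 2 : ℝ) with hA
  have hAt : A ≠ ⊤ := ENNReal.rpow_ne_top_of_nonneg (by norm_num) ENNReal.coe_ne_top
  set Cc : ℝ≥0∞ := ENNReal.ofReal C₃ ^ (3 / 2 : ℝ) * (V₁ ^ (1 / 2 : ℝ) * V₁) with hCc
  have hCct : Cc ≠ ⊤ :=
    ENNReal.mul_ne_top (ENNReal.rpow_ne_top_of_nonneg (by norm_num) ENNReal.ofReal_ne_top)
      (ENNReal.mul_ne_top (ENNReal.rpow_ne_top_of_nonneg (by norm_num) hV₁t) hV₁t)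
  set c : ℝ≥0∞ := 4 * (A + 1) * (Cc + 1) with hc
  have hct : c ≠ ⊤ :=
    ENNReal.mul_ne_top (ENNReal.mul_ne_top (by norm_num)
      (ENNReal.add_ne_top.2 ⟨hAt, ENNReal.one_ne_top⟩))
      (ENNReal.add_ne_top.2 ⟨hCct, ENNReal.one_ne_top⟩)
  refine ⟨c.toNNReal, fun x₀ r ϱ p u hϱ hϱr hpm hum hpI huI hid => ?_⟩
  rw [ENNReal.coe_toNNReal hct]
  have hr : 0 < r := by linarith
  have hϱr' : ϱ ≤ r / 2 := by linarith
  have hθ1 : ENNReal.ofReal ((ϱ / r) ^ 3) ≤ 1 := by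
    refine ENNReal.ofReal_le_one.2 (pow_le_one₀ (div_nonneg hϱ.le hr.le) ?_)
    rw [div_le_one hr]; linarith
  haveI hfin : IsFiniteMeasure (volume.restrict (ball x₀ r)) :=
    ⟨by rw [Measure.restrict_apply_univ]; exact measure_ball_lt_top⟩
  -- exponent bookkeeping
  have h32 : (3 / 2 : ℝ≥0∞).toReal = 3 / 2 := by rw [ENNReal.toReal_div]; norm_num
  have h32_0 : (3 / 2 : ℝ≥0∞) ≠ 0 := by norm_num
  have h32_t : (3 / 2 : ℝ≥0∞) ≠ ⊤ := (ENNReal.div_lt_top ENNReal.ofNat_ne_top two_ne_zero).ne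
  have h1le : (1 : ℝ≥0∞) ≤ 3 / 2 := by
    rw [ENNReal.le_div_iff_mul_le (Or.inl two_ne_zero) (Or.inl ENNReal.ofNat_ne_top)]; norm_num
  have h3rpow : ∀ y : ℝ≥0∞, y ^ (3 : ℝ) = y ^ (3 : ℕ) := fun y => by
    rw [show (3 : ℝ) = ((3 : ℕ) : ℝ) by norm_num, ENNReal.rpow_natCast]
  have heLp32 : ∀ (μ : Measure (EuclideanSpace ℝ (Fin 3))) (f : EuclideanSpace ℝ (Fin 3) → ℝ),
      eLpNorm f (3 / 2) μ = (∫⁻ x, ‖f x‖ₑ ^ (3 / 2 : ℝ) ∂μ) ^ (1 / (3 / 2 : ℝ)) := fun μ f => by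
    rw [eLpNorm_eq_lintegral_rpow_enorm_toReal h32_0 h32_t, h32]
  have heLp3 : ∀ (μ : Measure (EuclideanSpace ℝ (Fin 3)))
      (f : EuclideanSpace ℝ (Fin 3) → EuclideanSpace ℝ (Fin 3)),
      eLpNorm f 3 μ = (∫⁻ x, ‖f x‖ₑ ^ (3 : ℕ) ∂μ) ^ (1 / (3 : ℝ)) := fun μ f => by
    rw [eLpNorm_eq_lintegral_rpow_enorm_toReal (by norm_num) (by norm_num), ENNReal.toReal_ofNat]
    simp_rw [h3rpow]
  -- `p ∈ L^{3/2}(B_r) ⊆ L¹(B_r)`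
  have hpmem : MemLp p (3 / 2) (volume.restrict (ball x₀ r)) := by
    refine ⟨hpm, ?_⟩
    rw [heLp32]
    exact ENNReal.rpow_lt_top_of_nonneg (by norm_num) hpI.ne
  have hpint : IntegrableOn p (ball x₀ r) volume := hpmem.integrable h1le
  -- `U = χ_{B_r} u ∈ L³(ℝ³)`
  set U : EuclideanSpace ℝ (Fin 3) → EuclideanSpace ℝ (Fin 3) := (ball x₀ r).indicator u with hU
  have hUm : AEStronglyMeasurable U volume :=
    (aestronglyMeasurable_indicator_iff measurableSet_ball).2 hum
  have hUnorm : eLpNorm U 3 volume = eLpNorm u 3 (volume.restrict (ball x₀ r)) :=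
    eLpNorm_indicator_eq_eLpNorm_restrict measurableSet_ball
  have hUI : ∫⁻ x, ‖U x‖ₑ ^ (3 : ℕ) = ∫⁻ x in ball x₀ r, ‖u x‖ₑ ^ (3 : ℕ) := by
    rw [← lintegral_indicator measurableSet_ball]
    refine lintegral_congr fun x => ?_
    rw [hU, enorm_indicator_eq_indicator_enorm]
    by_cases hx : x ∈ ball x₀ r
    · rw [indicator_of_mem hx, indicator_of_mem hx]
    · rw [indicator_of_notMem hx, indicator_of_notMem hx, zero_pow three_ne_zero]
  set Ip := ∫⁻ x in ball x₀ r, ‖p x‖ₑ ^ (3 / 2 : ℝ) with hIp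
  set Iu := ∫⁻ x in ball x₀ r, ‖u x‖ₑ ^ (3 : ℕ) with hIu
  have hUmem : MemLp U 3 volume := by
    refine ⟨hUm, ?_⟩
    rw [heLp3, hUI]
    exact ENNReal.rpow_lt_top_of_nonneg (by norm_num) huI.ne
  -- the whole-space pressure `P = p₁` of `U`
  obtain ⟨P, hPmem, hPle, hPid⟩ := hC U hUmem
  have hIP : ∫⁻ x, ‖P x‖ₑ ^ (3 / 2 : ℝ) ≤ A * ∫⁻ x in ball x₀ r, ‖u x‖ₑ ^ (3 : ℕ) := by
    rw [heLp32, heLp3, hUI] at hPle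
    have h := ENNReal.rpow_le_rpow hPle (by norm_num : (0 : ℝ) ≤ 3 / 2)
    rw [← ENNReal.rpow_mul, show (1 / (3 / 2 : ℝ)) * (3 / 2) = 1 by norm_num, ENNReal.rpow_one,
      ENNReal.mul_rpow_of_nonneg _ _ (by norm_num : (0 : ℝ) ≤ 3 / 2), ← ENNReal.rpow_natCast,
      ← ENNReal.rpow_mul, ← ENNReal.rpow_mul,
      show (1 / (3 : ℝ)) * (((2 : ℕ) : ℝ) * (3 / 2)) = 1 by norm_num, ENNReal.rpow_one] at h
    exact h
  have hPint : IntegrableOn P (ball x₀ r) volume := (hPmem.restrict (ball x₀ r)).integrable h1le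
  -- the harmonic part `h = p₂ = p - P`
  set h : EuclideanSpace ℝ (Fin 3) → ℝ := fun x => p x - P x with hh
  have hhint : IntegrableOn h (ball x₀ r) volume := hpint.sub hPint
  have hharm : ∀ φ : EuclideanSpace ℝ (Fin 3) → ℝ, ContDiff ℝ (⊤ : ℕ∞) φ → HasCompactSupport φ →
      tsupport φ ⊆ ball x₀ r → ∫ x, h x * (Δ φ) x = 0 := by
    intro φ hφ hφc hφs
    have hφ2 : ContDiff ℝ 2 φ := contDiff_infty.1 hφ 2
    have hΔc : Continuous (Δ φ) := FluidPDE.continuous_laplacian hφ2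
    have hΔ0 : ∀ x ∉ tsupport φ, Δ φ x = 0 := fun x hx =>
      FluidPDE.laplacian_eq_zero_of_notMem_tsupport hx
    have hK : IsCompact (tsupport φ) := hφc
    -- integrability of `p Δφ` and `P Δφ`
    have hi : ∀ {g : EuclideanSpace ℝ (Fin 3) → ℝ}, IntegrableOn g (ball x₀ r) volume →
        Integrable (fun x => g x * (Δ φ) x) := fun hg => by
      have h1 := integrable_mul_of_eq_zero_off_compact hK hΔc hΔ0 (hg.mono_set hφs)
      simpa only [mul_comm] using h1
    have e : (fun x => h x * (Δ φ) x) = fun x => p x * (Δ φ) x - P x * (Δ φ) x := by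
      funext x; simp only [hh, sub_mul]
    rw [e, integral_sub (hi hpint) (hi hPint), hid φ hφ hφc hφs, hPid φ hφ hφc]
    -- `D²φ(U, U) = D²φ(u, u)` pointwise
    have e2 : (fun x => fderiv ℝ (fderiv ℝ φ) x (U x) (U x)) =
        fun x => fderiv ℝ (fderiv ℝ φ) x (u x) (u x) := by
      funext x
      by_cases hx : x ∈ ball x₀ r
      · simp only [hU, indicator_of_mem hx]
      · have hx' : x ∉ tsupport φ := fun h' => hx (hφs h')
        rw [fderiv_fderiv_eq_zero_of_notMem_tsupport hx']
        simp
    rw [e2, sub_self]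
  -- the interior bound for `h` on `B_{r/2}`, hence on `B_ϱ`
  have hB := hB3 h x₀ r hr hhint hharm
  set Λ : ℝ≥0∞ := ENNReal.ofReal (C₃ * (r ^ 3)⁻¹ * ∫ y in ball x₀ r, |h y|) with hΛ
  have hae : ∀ᵐ x ∂(volume.restrict (ball x₀ ϱ)), ‖h x‖ₑ ^ (3 / 2 : ℝ) ≤ Λ ^ (3 / 2 : ℝ) := by
    have h1 := ae_restrict_of_ae_restrict_of_subset (ball_subset_ball hϱr') hB
    filter_upwards [h1] with x hx
    refine ENNReal.rpow_le_rpow ?_ (by norm_num)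
    rw [Real.enorm_eq_ofReal_abs]
    exact ENNReal.ofReal_le_ofReal hx
  -- `Λ ≤ C₃ r⁻³ ∫⁻_{B_r} ‖h‖ₑ`
  have hΛeq : Λ = ENNReal.ofReal C₃ * ENNReal.ofReal ((r ^ 3)⁻¹) * ∫⁻ y in ball x₀ r, ‖h y‖ₑ := by
    rw [hΛ, ENNReal.ofReal_mul (mul_nonneg hC₃0 (inv_nonneg.2 (pow_nonneg hr.le 3))),
      ENNReal.ofReal_mul hC₃0]
    congr 1
    have e : (∫ y in ball x₀ r, |h y|) = ∫ y in ball x₀ r, ‖h y‖ := by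
      simp only [Real.norm_eq_abs]
    rw [e, ofReal_integral_norm_eq_lintegral_enorm hhint]
  -- Hölder: `(∫⁻_{B_r} ‖h‖ₑ)^{3/2} ≤ |B_r|^{1/2} ∫⁻_{B_r} ‖h‖ₑ^{3/2}`
  have hHolder : (∫⁻ y in ball x₀ r, ‖h y‖ₑ) ^ (3 / 2 : ℝ) ≤
      (volume (ball x₀ r)) ^ (1 / 2 : ℝ) * ∫⁻ y in ball x₀ r, ‖h y‖ₑ ^ (3 / 2 : ℝ) := by
    have h1 := lintegral_enorm_rpow_threeHalves_le (μ := volume.restrict (ball x₀ r))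
      (hpm.sub (hPmem.restrict _).1)
    rwa [Measure.restrict_apply_univ] at h1
  -- `∫⁻_{B_r} ‖h‖ₑ^{3/2} ≤ 2 (∫⁻_{B_r} ‖p‖ₑ^{3/2} + A ∫⁻_{B_r} ‖u‖ₑ³)`
  have hIh : ∫⁻ y in ball x₀ r, ‖h y‖ₑ ^ (3 / 2 : ℝ) ≤
      2 * ((∫⁻ x in ball x₀ r, ‖p x‖ₑ ^ (3 / 2 : ℝ)) +
        A * ∫⁻ x in ball x₀ r, ‖u x‖ₑ ^ (3 : ℕ)) := by
    calc ∫⁻ y in ball x₀ r, ‖h y‖ₑ ^ (3 / 2 : ℝ)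
        ≤ ∫⁻ y in ball x₀ r, 2 * (‖p y‖ₑ ^ (3 / 2 : ℝ) + ‖P y‖ₑ ^ (3 / 2 : ℝ)) := by
          refine lintegral_mono fun y => ?_
          refine le_trans (ENNReal.rpow_le_rpow ?_ (by norm_num))
            (rpow_threeHalves_add_le_two_mul _ _)
          calc ‖h y‖ₑ = ‖p y + (-P y)‖ₑ := by simp only [hh, sub_eq_add_neg]
            _ ≤ ‖p y‖ₑ + ‖-P y‖ₑ := enorm_add_le _ _
            _ = ‖p y‖ₑ + ‖P y‖ₑ := by rw [enorm_neg]
      _ = 2 * ((∫⁻ y in ball x₀ r, ‖p y‖ₑ ^ (3 / 2 : ℝ)) +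
            ∫⁻ y in ball x₀ r, ‖P y‖ₑ ^ (3 / 2 : ℝ)) := by
          rw [lintegral_const_mul' _ _ (by norm_num), lintegral_add_left' (hpm.enorm.pow_const _)]
      _ ≤ 2 * ((∫⁻ x in ball x₀ r, ‖p x‖ₑ ^ (3 / 2 : ℝ)) +
            A * ∫⁻ x in ball x₀ r, ‖u x‖ₑ ^ (3 : ℕ)) := by
          gcongr
          exact (setLIntegral_le_lintegral _ _).trans hIP
  -- volumes of balls
  have hd : Module.finrank ℝ (EuclideanSpace ℝ (Fin 3)) = 3 := by simp
  have hVr : volume (ball x₀ r) = ENNReal.ofReal (r ^ 3) * V₁ := by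
    rw [Measure.addHaar_ball_of_pos volume x₀ hr, hd]
  have hVϱ : volume (ball x₀ ϱ) = ENNReal.ofReal (ϱ ^ 3) * V₁ := by
    rw [Measure.addHaar_ball_of_pos volume x₀ hϱ, hd]
  -- the harmonic part on `B_ϱ`
  have hIhϱ : ∫⁻ x in ball x₀ ϱ, ‖h x‖ₑ ^ (3 / 2 : ℝ) ≤
      Cc * ENNReal.ofReal ((ϱ / r) ^ 3) * ∫⁻ y in ball x₀ r, ‖h y‖ₑ ^ (3 / 2 : ℝ) := by
    calc ∫⁻ x in ball x₀ ϱ, ‖h x‖ₑ ^ (3 / 2 : ℝ) ≤ ∫⁻ x in ball x₀ ϱ, Λ ^ (3 / 2 : ℝ) :=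
          lintegral_mono_ae hae
      _ = Λ ^ (3 / 2 : ℝ) * volume (ball x₀ ϱ) := setLIntegral_const _ _
      _ ≤ (ENNReal.ofReal C₃ * ENNReal.ofReal ((r ^ 3)⁻¹)) ^ (3 / 2 : ℝ) *
            ((volume (ball x₀ r)) ^ (1 / 2 : ℝ) * ∫⁻ y in ball x₀ r, ‖h y‖ₑ ^ (3 / 2 : ℝ)) *
            volume (ball x₀ ϱ) := by
          rw [hΛeq, ENNReal.mul_rpow_of_nonneg _ _ (by norm_num : (0 : ℝ) ≤ 3 / 2)]
          gcongr
      _ = Cc * ENNReal.ofReal ((ϱ / r) ^ 3) * ∫⁻ y in ball x₀ r, ‖h y‖ₑ ^ (3 / 2 : ℝ) := by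
          rw [hVr, hVϱ, hCc, ← ofReal_cube_inv_rpow_mul r ϱ hr,
            ENNReal.mul_rpow_of_nonneg _ _ (by norm_num : (0 : ℝ) ≤ 3 / 2),
            ENNReal.mul_rpow_of_nonneg _ _ (by norm_num : (0 : ℝ) ≤ 1 / 2)]
          ring
  -- assembly
  set θ := ENNReal.ofReal ((ϱ / r) ^ 3) with hθ
  have hpmϱ : AEStronglyMeasurable p (volume.restrict (ball x₀ ϱ)) :=
    hpm.mono_measure (Measure.restrict_mono (ball_subset_ball (by linarith)) le_rfl)
  have hPmϱ : AEStronglyMeasurable P (volume.restrict (ball x₀ ϱ)) := (hPmem.restrict _).1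
  calc ∫⁻ x in ball x₀ ϱ, ‖p x‖ₑ ^ (3 / 2 : ℝ)
      ≤ ∫⁻ x in ball x₀ ϱ, 2 * (‖P x‖ₑ ^ (3 / 2 : ℝ) + ‖h x‖ₑ ^ (3 / 2 : ℝ)) := by
        refine lintegral_mono fun x => ?_
        refine le_trans (ENNReal.rpow_le_rpow ?_ (by norm_num))
          (rpow_threeHalves_add_le_two_mul _ _)
        calc ‖p x‖ₑ = ‖P x + h x‖ₑ := by simp only [hh, add_sub_cancel]
          _ ≤ ‖P x‖ₑ + ‖h x‖ₑ := enorm_add_le _ _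
    _ = 2 * ((∫⁻ x in ball x₀ ϱ, ‖P x‖ₑ ^ (3 / 2 : ℝ)) +
          ∫⁻ x in ball x₀ ϱ, ‖h x‖ₑ ^ (3 / 2 : ℝ)) := by
        rw [lintegral_const_mul' _ _ (by norm_num), lintegral_add_left' (hPmϱ.enorm.pow_const _)]
    _ ≤ 2 * (A * Iu + Cc * θ * (2 * (Ip + A * Iu))) := by
        gcongr
        · exact (setLIntegral_le_lintegral _ _).trans hIP
        · exact hIhϱ.trans (mul_le_mul_right hIh _)
    _ = 2 * A * Iu + 4 * Cc * θ * Ip + 4 * A * Cc * (θ * Iu) := by ring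
    _ ≤ 4 * A * Iu + 4 * Cc * θ * Ip + 4 * A * Cc * (1 * Iu) := by
        gcongr ?_ * A * Iu + 4 * Cc * θ * Ip + 4 * A * Cc * (?_ * Iu)
        · norm_num
    _ ≤ c * (θ * Ip + Iu) := by
        rw [hc, one_mul]
        have e : 4 * (A + 1) * (Cc + 1) * (θ * Ip + Iu) =
            (4 * A * Iu + 4 * Cc * θ * Ip + 4 * A * Cc * Iu) +
              (4 * A * Cc * θ * Ip + 4 * A * θ * Ip + 4 * θ * Ip + 4 * Cc * Iu + 4 * Iu) := by
          ring
        rw [e]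
        exact le_self_add

end Slice

end Literature.Analysis.FluidPDE

end
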